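import Literature.AlgebraicGeometry.AbelianSchemes.PolarizationOntoGeometricPoints
import Literature.AlgebraicGeometry.AbelianSchemes.IsLambdaOfAtMulAdd
import Literature.AlgebraicGeometry.AbelianVarieties.AbelianVarietyWeilDivisorBundleDictionary
import Literature.AlgebraicGeometry.Motives.AbelianVarietyWeilPairingRadical
import HarnessLib

/-!
# The kernel of `λ̄_s` on geometric points lies in `K(Θ)` for every witness `λ̄_s = Λ(𝒪(Θ))` — so it is FINITE by Def. 6.3
# alone, and `λ̄_s` is an isogeny, onto on geometric points, as soon as `dim Â_s = dim A_s` (NO type `δ` needed)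

Layer `Literature/AlgebraicGeometry/AbelianSchemes`, namespace `Literature.AlgebraicGeometry.AbelianSchemes.AbelianSchemeOver`
(`IsLambdaOfAt.…`, `Polarization.…`).  THEOREMS ONLY (no definition, no named fact, no instance, no `sorry`).

[MumfordFogartyKirwan1994] Ch. 6 §2 Def. 6.2 (p. 120) «`Λ(L)(x) = T_x^*L ⊗ L⁻¹`» and Def. 6.3 «a polarization … `λ̄ = Λ(L̄)`
for some ample invertible sheaf `L̄`»; [MumfordAV1970] §6 Application 1 (p. 60) / §8 (pp. 74–77): for `L` ample the group
`K(L) = {x : T_x^*L ≅ L}` is FINITE, and `Λ(L) : X → X̂` has kernel `K(L)` on points; §8 Thm. 1 (p. 77): `Λ(L)` is then an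
isogeny.  The tree's D2 carrier ★ `AbelianSchemePolarization` types Def. 6.3 verbatim (`Polarization.exists_ample`: an AMPLE
Cartier divisor `Θ` with `IsLambdaOfAt s D λ Θ` at every geometric point) and the kernel of `λ̄_s` on `Ω`-points as
`Polarization.kerPointsAt s`; the existing finiteness/isogeny results (★ `Polarization.finite_setOf_comp_fibreHom_lam_eq_one`,
★ `Polarization.isIsogeny_fibreHom_lam`, ★ `exists_comp_lam_eq_of_dim_hat`, file `PolarizationOntoGeometricPoints`) take the
TYPE clause `hT : pol.HasType δ` as input.  This file removes that input:

* §1 **`IsLambdaOfAt.weilDiv_linEquiv_weilDiv_of_valueAt_eq`** — for a witness `λ̄_s = Λ(𝒪(Θ))`, two `Ω`-points `P, Q` of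
  `A_s` with the same value `λ̄(P) = λ̄(Q)` have linearly equivalent Weil divisors `D_P(Θ) ∼ D_Q(Θ)` (`D_P = t_P^*Θ − Θ`): the
  slices `𝒫|_{A_s × {λ̄(P)}}` and `𝒫|_{A_s × {λ̄(Q)}}` are the same module (★ `sliceAt_obj_eq_pullbackP`, ★ `DualPair.pullbackP_congr`),
  `IsLambdaOfAt` identifies them with `t_P^*𝒪(Θ) ⊗ 𝒪(Θ)⁻¹`, `t_Q^*𝒪(Θ) ⊗ 𝒪(Θ)⁻¹`, and the (D-2) dictionary ★
  `weilDiv_linEquiv_iff_nonempty_translateTensorDual_iso` ([Hartshorne1977] III Ex. 4.5 / [GortzWedhorn2020] Prop. 11.21) turns the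
  module isomorphism into the linear equivalence; `IsLambdaOfAt.weilDiv_linEquiv_zero_of_valueAt_eq_valueAt_one` (`Q = 1`);
* §2 **`Polarization.kerPointsAt_subset_KTheta`** — `ker λ̄_s ⊆ K(Θ)` (★ `AbelianVariety.KTheta`) for every `IsLambdaOfAt` witness;
  **`Polarization.finite_kerPointsAt`** — the kernel of a POLARISATION on `Ω`-points is finite (Def. 6.3's ample witness + ★
  `finite_KTheta`, [MumfordAV1970] §6 App. 1); `Polarization.finite_setOf_comp_fibreHom_lam_eq_one'` (the `fibreHom` spelling);
* §3 **`Polarization.isIsogeny_fibreHom_lam_of_dim_eq`** — `λ̄_s` is an ISOGENY whenever `dim Â_s = dim A_s` ([MumfordAV1970] §8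
  Thm. 1; finite kernel on points ⇒ zero-dimensional kernel ⇒ finite kernel scheme ⇒ isogeny in equal dimensions, the ★ road of
  `isIsogeny_fibreHom_lam`); **`Polarization.exists_comp_lam_eq_of_dim_eq`** — `λ̄_s` is onto on geometric points (`FibrePoints`
  currency, the `hsurj` binder shape of the cell's (X-amp)/(u5) consumers) — both WITHOUT `HasType`.

Cell `hodgecm-mathlib` (D-0151): count-neutral capital under the standing GO (B-p11 (g14), 2026-08-30T01:19Z; makes ★ (B1)
`Polarization.etale/flat/surjective_lam_left` and the ISO-pts chain available for untyped polarisations).  HC_CM is proved only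
modulo the 7 printed citations until rung 0 closes; this file discharges none of them.

## References
* [MumfordFogartyKirwan1994] D. Mumford, J. Fogarty, F. Kirwan, *GIT* 3rd ed. (1994), Ch. 6 §2 Def. 6.2–6.3 (p. 120).
* [MumfordAV1970] D. Mumford, *Abelian Varieties* (1970), §6 Application 1 (p. 60), §8 Thm. 1 (p. 77), §7 Thm. 4 (p. 72).
* [GortzWedhorn2023] U. Görtz, T. Wedhorn, *Algebraic Geometry II* (2023), Prop. 27.176 and Cor. 27.177.
* [Hartshorne1977] R. Hartshorne, *Algebraic Geometry* (1977), III Ex. 4.5.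
* [GortzWedhorn2020] U. Görtz, T. Wedhorn, *Algebraic Geometry I*, 2nd ed. (2020), Prop. 11.21 (p. 374), Section (4.7) (p. 108).
-/

set_option autoImplicit false

noncomputable section

universe u

open CategoryTheory CategoryTheory.Limits AlgebraicGeometry MonoidalCategory

namespace Literature.AlgebraicGeometry.AbelianSchemes

namespace AbelianSchemeOver

open Literature.AlgebraicGeometry.Motives Literature.AlgebraicGeometry.AbelianVarieties Literature.AlgebraicGeometry.Modules
open scoped MonObj

variable {S : Scheme.{u}} {A : AbelianSchemeOver S} {D : A.DualPair}

/-! ### §1 Equal values `λ̄(P) = λ̄(Q)` ⇒ `D_P(Θ) ∼ D_Q(Θ)` for a witness `λ̄ = Λ(𝒪(Θ))` -/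

/-- **`λ̄(P) = λ̄(Q) ⇒ D_P(Θ) ∼ D_Q(Θ)`** for a witness `λ̄_s = Λ(𝒪(Θ))` ([MumfordFogartyKirwan1994] Def. 6.2: `Λ(L)(x) = T_x^*L ⊗ L⁻¹`):
the slices of the Poincaré sheaf at `λ̄(P)` and `λ̄(Q)` coincide (★ `sliceAt_obj_eq_pullbackP` + ★ `DualPair.pullbackP_congr`), so
`t_P^*𝒪(Θ) ⊗ 𝒪(Θ)⁻¹ ≅ t_Q^*𝒪(Θ) ⊗ 𝒪(Θ)⁻¹`, i.e. (★ (D-2) dictionary `weilDiv_linEquiv_iff_nonempty_translateTensorDual_iso`)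
`t_P^*Θ − Θ ∼ t_Q^*Θ − Θ`. [cite: MumfordFogartyKirwan1994, Ch. 6 §2 Definition 6.2 (p. 120)] [cite: Hartshorne1977, III Ex. 4.5] -/
theorem IsLambdaOfAt.weilDiv_linEquiv_weilDiv_of_valueAt_eq {Ω : Type u} [Field Ω] {s : Spec (.of Ω) ⟶ S}
    {lam : A.X ⟶ D.hat.X} {Θ : CartierDivisor (A.fibre s).toAbelianVariety.X.left} (hΘ : A.IsLambdaOfAt s D lam Θ)
    {P Q : (A.fibre s).toAbelianVariety.Points Ω} (hPQ : A.valueAt s D lam P = A.valueAt s D lam Q) :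
    ((A.fibre s).toAbelianVariety.weilDiv Θ P).LinEquiv ((A.fibre s).toAbelianVariety.weilDiv Θ Q) := by
  obtain ⟨eP⟩ := hΘ P
  obtain ⟨eQ⟩ := hΘ Q
  have hslice : (Scheme.Modules.pullback (A.sliceAt s D lam P)).obj D.P =
      (Scheme.Modules.pullback (A.sliceAt s D lam Q)).obj D.P := by
    rw [sliceAt_obj_eq_pullbackP, sliceAt_obj_eq_pullbackP]
    exact D.pullbackP_congr s hPQ _ _
  exact (weilDiv_linEquiv_iff_nonempty_translateTensorDual_iso (A.fibre s).toAbelianVariety Θ Θ Q P).2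
    ⟨eP.symm ≪≫ eqToIso hslice ≪≫ eQ⟩

/-- **`λ̄(P) = λ̄(1) ⇒ D_P(Θ) ∼ 0`** (`D_1 ∼ 0`, ★ `weilDiv_one_linEquiv_zero`): a point in the kernel of `λ̄_s` on `Ω`-points has
`t_P^*Θ ∼ Θ` — [MumfordAV1970] §8: the kernel of `Λ(L)` on points is `K(L)`. [cite: MumfordAV1970, §8 (definition of φ_L)]
[cite: MumfordFogartyKirwan1994, Ch. 6 §2 Definition 6.2 (p. 120)] -/
theorem IsLambdaOfAt.weilDiv_linEquiv_zero_of_valueAt_eq_valueAt_one {Ω : Type u} [Field Ω] {s : Spec (.of Ω) ⟶ S}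
    {lam : A.X ⟶ D.hat.X} {Θ : CartierDivisor (A.fibre s).toAbelianVariety.X.left} (hΘ : A.IsLambdaOfAt s D lam Θ)
    {P : (A.fibre s).toAbelianVariety.Points Ω} (hP : A.valueAt s D lam P = A.valueAt s D lam 1) :
    ((A.fibre s).toAbelianVariety.weilDiv Θ P).LinEquiv 0 :=
  (hΘ.weilDiv_linEquiv_weilDiv_of_valueAt_eq hP).trans ((A.fibre s).toAbelianVariety.weilDiv_one_linEquiv_zero Θ)

/-! ### §2 `ker λ̄_s ⊆ K(Θ)`; the kernel of a polarisation on geometric points is finite -/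

variable (pol : A.Polarization D)

/-- **`ker λ̄_s ⊆ K(Θ)`** on `Ω`-points, for every witness `λ̄_s = Λ(𝒪(Θ))` ([MumfordAV1970] §8: `ker Λ(L) = K(L)` on points; the
tree's `Polarization.kerPointsAt` and ★ `AbelianVariety.KTheta`). [cite: MumfordAV1970, §8 (definition of φ_L)]
[cite: MumfordFogartyKirwan1994, Ch. 6 §2 Definition 6.3 (p. 120)] -/
theorem Polarization.kerPointsAt_subset_KTheta {Ω : Type u} [Field Ω] {s : Spec (.of Ω) ⟶ S}
    {Θ : CartierDivisor (A.fibre s).toAbelianVariety.X.left} (hΘ : A.IsLambdaOfAt s D pol.lam Θ) :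
    pol.kerPointsAt s ⊆ ((A.fibre s).toAbelianVariety.KTheta Θ : Set ((A.fibre s).toAbelianVariety.Points Ω)) :=
  fun P hP => ((A.fibre s).toAbelianVariety.mem_KTheta_iff Θ P).2
    (hΘ.weilDiv_linEquiv_zero_of_valueAt_eq_valueAt_one ((pol.mem_kerPointsAt_iff s P).1 hP))

/-- **THE KERNEL OF A POLARISATION ON GEOMETRIC POINTS IS FINITE** — from [MumfordFogartyKirwan1994] Def. 6.3 alone (no type
`δ`): `λ̄_s = Λ(𝒪(Θ))` with `Θ` AMPLE (`Polarization.exists_ample`), so `ker λ̄_s ⊆ K(Θ)`, which is finite for ample `Θ`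
([MumfordAV1970] §6 Application 1, ★ `finite_KTheta`). [cite: MumfordAV1970, §6 Application 1 (p. 60)]
[cite: MumfordFogartyKirwan1994, Ch. 6 §2 Definition 6.3 (p. 120)] -/
theorem Polarization.finite_kerPointsAt ⦃Ω : Type u⦄ [Field Ω] [IsAlgClosed Ω] (s : Spec (.of Ω) ⟶ S) :
    (pol.kerPointsAt s).Finite := by
  obtain ⟨Θ, hΘa, hΘ⟩ := pol.exists_ample Ω s
  exact ((A.fibre s).toAbelianVariety.finite_KTheta hΘa).subset (pol.kerPointsAt_subset_KTheta hΘ)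

/-- The same in the `fibreHom` spelling: `{R | λ_s(R) = 1}` is finite (★ `setOf_algPointsMap_fibreHom_eq_one_eq_kerPointsAt`), the
hypothesis-free twin of ★ `Polarization.finite_setOf_comp_fibreHom_lam_eq_one`. [cite: MumfordAV1970, §6 Application 1 (p. 60)] -/
theorem Polarization.finite_setOf_comp_fibreHom_lam_eq_one' [IsMonHom pol.lam] ⦃Ω : Type u⦄ [Field Ω] [IsAlgClosed Ω]
    (s : Spec (.of Ω) ⟶ S) :
    {R : (A.fibre s).toAbelianVariety.Points Ω | R ≫ (fibreHom pol.lam s).hom.hom.hom = 1}.Finite := by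
  have hset : {R : (A.fibre s).toAbelianVariety.Points Ω | R ≫ (fibreHom pol.lam s).hom.hom.hom = 1} =
      pol.kerPointsAt s :=
    setOf_algPointsMap_fibreHom_eq_one_eq_kerPointsAt pol s
  rw [hset]
  exact pol.finite_kerPointsAt s

/-! ### §3 `λ̄_s` is an isogeny, onto on geometric points, when `dim Â_s = dim A_s` — without `HasType` -/

/-- **`λ̄_s` IS AN ISOGENY at every geometric point where `dim Â_s = dim A_s`**, for EVERY polarisation ([MumfordAV1970] §8 Thm. 1:
`Λ(L)` for `L` ample is an isogeny; finite kernel on points (`finite_setOf_comp_fibreHom_lam_eq_one'`) ⇒ zero-dimensional kernel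
(★ `topologicalKrullDim_ker_le_zero_of_finite`) ⇒ finite kernel scheme (★ `isFinite_kerToSpec_of_topologicalKrullDim_le_zero`) ⇒
isogeny in equal dimensions (★ `IsIsogeny.of_isFinite_kerToSpec`, [GortzWedhorn2023] Prop. 27.176 / Cor. 27.177)) — the
`HasType`-free form of ★ `Polarization.isIsogeny_fibreHom_lam`. [cite: MumfordAV1970, §8 Thm. 1 (p. 77)]
[cite: GortzWedhorn2023, Prop. 27.176 and Cor. 27.177] -/
theorem Polarization.isIsogeny_fibreHom_lam_of_dim_eq [IsMonHom pol.lam] ⦃Ω : Type u⦄ [Field Ω] [IsAlgClosed Ω]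
    (s : Spec (.of Ω) ⟶ S) (hdim : (A.fibre s).toAbelianVariety.dim = (D.hat.fibre s).toAbelianVariety.dim) :
    AbelianVariety.IsIsogeny (fibreHom pol.lam s) := by
  have hker := AbelianVariety.topologicalKrullDim_ker_le_zero_of_finite (fibreHom pol.lam s)
    (pol.finite_setOf_comp_fibreHom_lam_eq_one' s)
  haveI := AbelianVariety.isFinite_kerToSpec_of_topologicalKrullDim_le_zero (fibreHom pol.lam s) hker
  exact AbelianVariety.IsIsogeny.of_isFinite_kerToSpec (fibreHom pol.lam s) hdim

/-- **`λ̄_s` is ONTO on geometric points when `dim Â_s = dim A_s`**, for every polarisation — every `y : Â.FibrePoints s` is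
`x ≫ λ` (the `hsurj` binder of the cell's (u5)/(X-amp) consumers; the `HasType`-free form of ★ `exists_comp_lam_eq_of_dim_hat`:
the isogeny is surjective, Ω-points lift ★ `AlgPoints.map_surjective_of_surjective_of_isAlgClosed`, partners ★
`FibreHomPointsOfFibrePoints`). [cite: MumfordAV1970, §8 Thm. 1 (p. 77)] [cite: GortzWedhorn2020, Section (4.7), (4.7.1) (p. 108)] -/
theorem Polarization.exists_comp_lam_eq_of_dim_eq [IsMonHom pol.lam] ⦃Ω : Type u⦄ [Field Ω] [IsAlgClosed Ω]
    (s : Spec (.of Ω) ⟶ S) (hdim : (A.fibre s).toAbelianVariety.dim = (D.hat.fibre s).toAbelianVariety.dim)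
    (y : D.hat.FibrePoints s) : ∃ x : A.FibrePoints s, x ≫ pol.lam = y := by
  have hiso := pol.isIsogeny_fibreHom_lam_of_dim_eq s hdim
  haveI : Surjective (fibreHom pol.lam s).hom.hom.hom.left := hiso.1
  obtain ⟨Q, hQ⟩ := D.hat.exists_points_fibrePointToLeft_eq s y
  obtain ⟨P, hP⟩ := AlgPoints.map_surjective_of_surjective_of_isAlgClosed (L := Ω) (fibreHom pol.lam s).hom.hom.hom Q
  obtain ⟨x, hx⟩ := A.exists_fibrePoints_fibrePointToLeft_eq s P
  refine ⟨x, fibrePoints_eq_of_fibrePointToLeft_eq (D.hat) s (P := Q) ?_ hQ⟩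
  rw [← hP]
  exact fibrePointToLeft_map_fibreHom_eq_comp_left s pol.lam hx

end AbelianSchemeOver

end Literature.AlgebraicGeometry.AbelianSchemes

end
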